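import Mathlib

/-!
# LocalSignRelabelling — the sign of the trace-zero element in the printed local dichotomy

T4-B4 Remark B4.8 (route/T4-B4-p1.md v5, owner p1) records the LOCAL face of the sign convention
of sub-claim B4: the printed theta-dichotomy condition for `U(1)` (Harris–Kudla–Sweet, J. AMS 9
(1996), Cor. 8.5, pp. 994–995) reads, for the skew-Hermitian line `⟨x, y⟩ = aδ x ȳ` and the
Hermitian line `(x, y) = b x̄ y` (`a, b ∈ F^×`, `δ̄ = −δ`), with a character `χ` of `E^×` whose
restriction to `F^×` is `ε_{E/F}`:

  `ε(1/2, χ η̃⁻¹, ψ_E) · η(−1) · χ(−δ) · ε_{E/F}(−2) = ε(V) ε(W)`,  `ε(V) = ε_{E/F}(b)`, `ε(W) = ε_{E/F}(a)`.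

The choice of the trace-zero element `δ` is a labelling (HKS96 p. 943 / p. 950: «if `n` is odd,
then the space `W = W_n^+` depends on the choice of `δ` … This fact must be reflected in our
formulas»): replacing `(a, δ)` by `(−a, −δ)` does not change the form `aδ x ȳ`, and the printed
condition is invariant under this relabelling because `χ(−1) = ε_{E/F}(−1)`.  This file
kernel-checks that invariance: `dichotomy_sign_invariant` (the identity `χ(−δ) ε(a) = χ(δ) ε(−a)`)
and `dichotomy_condition_iff` (the printed condition for `(a, δ)` holds iff it holds for
`(−a, −δ)`), for arbitrary characters `χ : E^× → ℂ^×`, `ε : F^× → ℂ^×` with `χ|_{F^×} = ε`.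

Only the algebra of the signs is formalised; the representation theory (the Weil representation,
the local root numbers) is not.
-/

namespace Summit.Ventures.HodgeRepro2

section LocalSign

variable {F E : Type*} [CommRing F] [Ring E] [Algebra F E]

/-- The unit `−δ ∈ E^×` is the image of `−1 ∈ F^×` times `δ`. -/
theorem neg_eq_map_neg_one_mul (δ : Eˣ) :
    -δ = Units.map (algebraMap F E).toMonoidHom (-1) * δ := by
  ext
  rw [Units.val_neg, Units.val_mul, Units.coe_map, RingHom.toMonoidHom_eq_coe, MonoidHom.coe_coe,
    Units.val_neg, Units.val_one, map_neg, map_one, neg_one_mul]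

/-- `ε(−1)² = 1` for every character `ε` of `F^×`. -/
theorem map_neg_one_mul_self (ε' : Fˣ →* ℂˣ) : ε' (-1) * ε' (-1) = 1 := by
  rw [← map_mul, neg_one_mul, neg_neg, map_one]

variable (χ : Eˣ →* ℂˣ) (ε : Fˣ →* ℂˣ)
  (hχ : ∀ x : Fˣ, χ (Units.map (algebraMap F E).toMonoidHom x) = ε x)

include hχ

/-- `χ(−δ) = ε(−1) χ(δ)` when `χ|_{F^×} = ε`. -/
theorem map_neg_eq_map_neg_one_mul (δ : Eˣ) : χ (-δ) = ε (-1) * χ δ := by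
  rw [neg_eq_map_neg_one_mul (F := F), map_mul, hχ]

/-- THE SIGN IDENTITY behind the relabelling `(a, δ) ↦ (−a, −δ)` of HKS96 Cor. 8.5:
`χ(−δ) · ε(a) = χ(δ) · ε(−a)`. -/
theorem dichotomy_sign_invariant (δ : Eˣ) (a : Fˣ) : χ (-δ) * ε a = χ δ * ε (-a) := by
  rw [map_neg_eq_map_neg_one_mul χ ε hχ, ← neg_one_mul a, map_mul, mul_assoc, mul_left_comm]

/-- THE PRINTED CONDITION IS INVARIANT: for any `X ∈ ℂ^×` (standing for
`ε(1/2, χη̃⁻¹, ψ_E) · η(−1) · ε_{E/F}(−2)`) and `b ∈ F^×`,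
`X · χ(−δ) = ε(b) ε(a)` holds if and only if `X · χ(δ) = ε(b) ε(−a)` —
the dichotomy set of characters `η` for the line `aδ x ȳ` does not see the labelling `(a, δ)`
versus `(−a, −δ)`. -/
theorem dichotomy_condition_iff (δ : Eˣ) (a b : Fˣ) (X : ℂˣ) :
    X * χ (-δ) = ε b * ε a ↔ X * χ δ = ε b * ε (-a) := by
  constructor
  · intro h
    have h2 : X * χ δ = ε (-1) * (ε (-1) * (X * χ δ)) := by
      rw [← mul_assoc, map_neg_one_mul_self, one_mul]
    have h3 : ε (-1) * (X * χ δ) = X * χ (-δ) := by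
      rw [map_neg_eq_map_neg_one_mul χ ε hχ]
      ac_rfl
    rw [h2, h3, h, ← neg_one_mul a, map_mul]
    ac_rfl
  · intro h
    rw [map_neg_eq_map_neg_one_mul χ ε hχ]
    have h3 : X * (ε (-1) * χ δ) = ε (-1) * (X * χ δ) := by ac_rfl
    rw [h3, h, ← neg_one_mul a, map_mul]
    have h4 : ε (-1) * (ε b * (ε (-1) * ε a)) = (ε (-1) * ε (-1)) * (ε b * ε a) := by ac_rfl
    rw [h4, map_neg_one_mul_self, one_mul]

end LocalSign

end Summit.Ventures.HodgeRepro2
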